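import Summits.Ventures.Crystal3D.Theorems.StickyWulffConstantGenericWallFloorLineCountUpper
import Summits.Ventures.Crystal3D.Theorems.StickyWulffConstantGenericWallFloorSlotSum
import HarnessLib

/-!
# Runs of one bond class through a convex slab sample, counted from ABOVE

HONEST FRAMING. Part of the venture `Summits/Ventures/Crystal3D` (cell `crystal3d-full`), helper for the
crux `GenericWallFloor` (stmt-Ventures-19480) of `route-Ventures-StickyWulffConstant`, line `WallLedgerG`:
module M1 of the rigid-bicrystal rung of `stub_twoSlabAdhesion` (note RIGID-RUNG-ARCH on the item).  By the
slot sum (`contactDeficiency_eq_half_sum_card_empty`) the deficiency of a sample `P′ ⊆ Λ₀` is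
`½ Σ_w #{p ∈ P′ : p + w ∉ P′}`; this file bounds ONE such term for a transversal class (`⟪W, ν⟫ ≠ 0`):

**Theorem** (`card_filter_add_notMem_le_lineCount`).  For the offset/window sample
`P′ = Λ₀ ∩ {lo ≤ ⟪q + s, ν⟫ ≤ lo + R, ‖q + s‖² − ⟪q + s, ν⟫² ≤ ρ²}` and a unimodular chart `(Ea, Eb, W)` of
`Λ₀` (every site is `a•Ea + b•Eb + t•W` with integer `a, b, t`; `‖Ea‖, ‖Eb‖ ≤ 1`, `‖W‖ = 1`, `det² = ½`,
`W` a slot), `#{p ∈ P′ : p + W ∉ P′} ≤ √2 |⟪W,ν⟫| π (ρ + (R/2 + 4)/|⟪W,ν⟫|)²`: by CONVEXITY of the sample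
region each bond line carries at most one such `p` (its last point), so these `p` inject into the lines
meeting the sample, counted by `lineCount_upper_offset_window`.

* `convex_offsetSampleRegion` — the offset/window sample region is convex.

WHAT THIS IS NOT: the horizontal classes (`⟪W, ν⟫ = 0`) and the sum over the twelve slots are not here;
rung F-C1 not moved.
-/

noncomputable section

namespace Summit.Ventures.Crystal3D.Theorems

open Summit.Ventures.Crystal3D Finset Matrix
open Literature.MathematicalPhysics.StatisticalMechanics (barlowPos fccStacking constHagg haggLabel_const
  barlowPos_mem)
open scoped InnerProductSpace

/-- The offset/window slab sample region is convex. -/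
theorem convex_offsetSampleRegion (ν s : EuclideanSpace ℝ (Fin 3)) (hν : ‖ν‖ = 1) (lo R ρ : ℝ)
    (hρ : 0 ≤ ρ) :
    Convex ℝ {q : EuclideanSpace ℝ (Fin 3) | lo ≤ ⟪q + s, ν⟫_ℝ ∧ ⟪q + s, ν⟫_ℝ ≤ lo + R ∧
      ‖q + s‖ ^ 2 - ⟪q + s, ν⟫_ℝ ^ 2 ≤ ρ ^ 2} := by
  intro p hp q hq a b ha hb hab
  simp only [Set.mem_setOf_eq] at hp hq ⊢
  obtain ⟨hp1, hp2, hp3⟩ := hp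
  obtain ⟨hq1, hq2, hq3⟩ := hq
  have hcomb : a • p + b • q + s = a • (p + s) + b • (q + s) := by
    rw [smul_add, smul_add]
    have : s = a • s + b • s := by rw [← add_smul, hab, one_smul]
    conv_lhs => rw [this]
    abel
  rw [hcomb]
  set p' := p + s
  set q' := q + s
  have hin : ⟪a • p' + b • q', ν⟫_ℝ = a * ⟪p', ν⟫_ℝ + b * ⟪q', ν⟫_ℝ := by
    rw [inner_add_left, inner_smul_left, inner_smul_left]; simp
  have hlo : a * lo + b * lo = lo := by rw [← add_mul, hab, one_mul]
  have hhi : a * (lo + R) + b * (lo + R) = lo + R := by rw [← add_mul, hab, one_mul]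
  refine ⟨?_, ?_, ?_⟩
  · rw [hin]
    have h1 := mul_le_mul_of_nonneg_left hp1 ha
    have h2 := mul_le_mul_of_nonneg_left hq1 hb
    linarith
  · rw [hin]
    have h1 := mul_le_mul_of_nonneg_left hp2 ha
    have h2 := mul_le_mul_of_nonneg_left hq2 hb
    linarith
  have hlat : ∀ r : EuclideanSpace ℝ (Fin 3), ‖r‖ ^ 2 - ⟪r, ν⟫_ℝ ^ 2 = ‖r - ⟪r, ν⟫_ℝ • ν‖ ^ 2 :=
    fun r => (norm_sub_inner_smul_sq ν r hν).symm
  rw [hlat] at hp3 hq3 ⊢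
  have hp4 : ‖p' - ⟪p', ν⟫_ℝ • ν‖ ≤ ρ := (sq_le_sq₀ (norm_nonneg _) hρ).1 hp3
  have hq4 : ‖q' - ⟪q', ν⟫_ℝ • ν‖ ≤ ρ := (sq_le_sq₀ (norm_nonneg _) hρ).1 hq3
  have e : a • p' + b • q' - ⟪a • p' + b • q', ν⟫_ℝ • ν =
      a • (p' - ⟪p', ν⟫_ℝ • ν) + b • (q' - ⟪q', ν⟫_ℝ • ν) := by
    rw [hin, smul_sub, smul_sub, smul_smul, smul_smul, add_smul]
    abel
  have hle : ‖a • p' + b • q' - ⟪a • p' + b • q', ν⟫_ℝ • ν‖ ≤ ρ := by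
    rw [e]
    calc ‖a • (p' - ⟪p', ν⟫_ℝ • ν) + b • (q' - ⟪q', ν⟫_ℝ • ν)‖
        ≤ ‖a • (p' - ⟪p', ν⟫_ℝ • ν)‖ + ‖b • (q' - ⟪q', ν⟫_ℝ • ν)‖ := norm_add_le _ _
      _ = a * ‖p' - ⟪p', ν⟫_ℝ • ν‖ + b * ‖q' - ⟪q', ν⟫_ℝ • ν‖ := by
          rw [norm_smul, norm_smul, Real.norm_eq_abs, Real.norm_eq_abs, abs_of_nonneg ha,
            abs_of_nonneg hb]
      _ ≤ a * ρ + b * ρ := by gcongr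
      _ = ρ := by rw [← add_mul, hab, one_mul]
  exact (sq_le_sq₀ (norm_nonneg _) hρ).2 hle

/-- **Runs of a transversal class, from above.**  See the module docstring. The chart is given by
three vectors `Ea, Eb, W` and integer coordinate functions `fa, fb, ft` of the site parameters
`(k, i, j)` with `barlowPos k i j = fa • Ea + fb • Eb + ft • W`. -/
theorem card_filter_add_notMem_le_lineCount (ν s : EuclideanSpace ℝ (Fin 3)) (hν : ‖ν‖ = 1)
    (lo R ρ : ℝ) (hR : 0 ≤ R) (hρ : 0 ≤ ρ)
    (P : Finset (EuclideanSpace ℝ (Fin 3)))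
    (hP : ∀ q, q ∈ P ↔ (q ∈ fccStacking 1 (Real.sqrt (2 / 3)) ∧ lo ≤ ⟪q + s, ν⟫_ℝ ∧
      ⟪q + s, ν⟫_ℝ ≤ lo + R ∧ ‖q + s‖ ^ 2 - ⟪q + s, ν⟫_ℝ ^ 2 ≤ ρ ^ 2))
    (Ea Eb W : EuclideanSpace ℝ (Fin 3)) (hEa : ‖Ea‖ ≤ 1) (hEb : ‖Eb‖ ≤ 1) (hW : ‖W‖ = 1)
    (hdet : (Matrix.det ![WithLp.ofLp Ea, WithLp.ofLp Eb, WithLp.ofLp W]) ^ 2 = 1 / 2)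
    (hα : ⟪W, ν⟫_ℝ ≠ 0) (hWslot : W ∈ fccSlots)
    (fa fb ft : ℤ → ℤ → ℤ → ℤ)
    (hchart : ∀ k i j : ℤ, barlowPos 1 (Real.sqrt (2 / 3)) constHagg k i j =
      (fa k i j : ℝ) • Ea + (fb k i j : ℝ) • Eb + (ft k i j : ℝ) • W) :
    ((P.filter fun p => p + W ∉ P).card : ℝ) ≤
      Real.sqrt 2 * |⟪W, ν⟫_ℝ| * Real.pi * (ρ + (R / 2 + 4) / |⟪W, ν⟫_ℝ|) ^ 2 := by
  classical
  set F := P.filter fun p => p + W ∉ P with hF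
  -- integer coordinates of the points of `F`
  have hcoord : ∀ p ∈ F, ∃ k i j : ℤ, p = barlowPos 1 (Real.sqrt (2 / 3)) constHagg k i j := by
    intro p hp
    exact ((hP p).1 (mem_filter.1 hp).1).1
  choose! kf pf qf hc using hcoord
  -- the line index
  set idx : EuclideanSpace ℝ (Fin 3) → ℤ × ℤ := fun p =>
    (fa (kf p) (pf p) (qf p), fb (kf p) (pf p) (qf p)) with hidx
  have hrepr : ∀ p ∈ F, p = ((idx p).1 : ℝ) • Ea + ((idx p).2 : ℝ) • Eb +
      (ft (kf p) (pf p) (qf p) : ℝ) • W := by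
    intro p hp
    conv_lhs => rw [hc p hp]
    rw [hchart]
  -- convexity: at most one point of `F` per line
  have hconv := convex_offsetSampleRegion ν s hν lo R ρ hρ
  have hinj : Set.InjOn idx ↑F := by
    intro p hp p' hp' hpp'
    have hpF := mem_coe.1 hp
    have hp'F := mem_coe.1 hp'
    have ep := hrepr p hpF
    have ep' := hrepr p' hp'F
    rw [← hpp'] at ep'
    set t : ℤ := ft (kf p) (pf p) (qf p)
    set t' : ℤ := ft (kf p') (pf p') (qf p')
    have hdiff : p' = p + ((t' : ℝ) - t) • W := by
      calc p' = ((idx p).1 : ℝ) • Ea + ((idx p).2 : ℝ) • Eb + (t' : ℝ) • W := ep'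
        _ = (((idx p).1 : ℝ) • Ea + ((idx p).2 : ℝ) • Eb + (t : ℝ) • W) + ((t' : ℝ) - t) • W := by
            module
        _ = p + ((t' : ℝ) - t) • W := by rw [← ep]
    -- the key step: if `t < t'` then `p + W` lies on the segment `[p, p']` inside the sample
    have key : ∀ (x y : EuclideanSpace ℝ (Fin 3)) (m : ℤ), x ∈ F → y ∈ P → y = x + (m : ℝ) • W →
        1 ≤ m → False := by
      intro x y m hx hy hyx hm
      have hxP : x ∈ P := (mem_filter.1 hx).1
      have hxW : x + W ∉ P := (mem_filter.1 hx).2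
      apply hxW
      rw [hP]
      refine ⟨add_mem_fcc_of_mem_fccSlots ((hP x).1 hxP).1 hWslot, ?_⟩
      -- `x + W = (1 - 1/m) • x + (1/m) • y`
      have hmR : (1 : ℝ) ≤ m := by exact_mod_cast hm
      have hm0 : (0 : ℝ) < m := by linarith
      have hcvx : x + W = (1 - 1 / (m : ℝ)) • x + (1 / (m : ℝ)) • y := by
        rw [hyx, smul_add, smul_smul, one_div, inv_mul_cancel₀ hm0.ne', one_smul]
        module
      have hxK := ((hP x).1 hxP).2
      have hyK := ((hP y).1 hy).2
      have hmem := hconv (x := x) (y := y) hxK hyK (a := 1 - 1 / (m : ℝ)) (b := 1 / (m : ℝ))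
        (by rw [sub_nonneg, div_le_one hm0]; exact hmR) (by positivity) (by ring)
      rw [← hcvx] at hmem
      exact hmem
    rcases lt_trichotomy t t' with hlt | heq | hgt
    · exact (key p p' (t' - t) hpF (mem_filter.1 hp'F).1 (by rw [hdiff]; push_cast; rfl)
        (by omega)).elim
    · rw [hdiff, heq, sub_self, zero_smul, add_zero]
    · refine (key p' p (t - t') hp'F (mem_filter.1 hpF).1 ?_ (by omega)).elim
      rw [hdiff]; push_cast; module
  -- the image satisfies the hypothesis of the upper line count
  set T := F.image idx with hT
  have hcard : (F.card : ℝ) = (T.card : ℝ) := by rw [hT, card_image_of_injOn hinj]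
  rw [hcard]
  refine lineCount_upper_offset_window ν hν R ρ lo hR hρ Ea Eb W s hEa hEb hW hdet hα T ?_
  intro ab hab
  obtain ⟨p, hp, rfl⟩ := mem_image.1 hab
  refine ⟨ft (kf p) (pf p) (qf p), ?_⟩
  have hpP := ((hP p).1 (mem_filter.1 hp).1).2
  rw [← hrepr p hp]
  exact hpP

end Summit.Ventures.Crystal3D.Theorems

end
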